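import Summits.ABC.ABC.Theorems.TwistAmplificationSharpModerateLawAbcOfDeepRegimeLawLemmas

/-!
# Crux `TwistAmplification.SharpModerateLaw` (stmt-ABC-1975), line `deep-moduli-cusp-dispersion`:
the deep-regime law alone implies the summit (calibration a2 of the hardest stub)

Registered calibration sub-goal `abc_of_lawOn_deepRegimeTw_of_facts` of stmt-ABC-1975: GIVEN the two
arithmetic facts about the prime quadratic twists `x = (d²c₄, d³c₆)` of the Frey pairs
`freyPair a b = (c₄, c₆)` of abc triples (a0 `twistedFreyPair_inj`: `x` determines `(a, b, d)`;
a1 `twistedFreyPair_facts`: the cusp invariants of `x` — `N* ≤ 2·rad(abc)·d²`, `r' = 1`,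
`c₄³ = M := (16A)³d⁶ ∈ [1728(cd)⁶, 4096(cd)⁶)`, `c₄³ − c₆² = 27648(abc)²d⁶`, every twist divisor divides
`4d`), the conclusion `LawOn DeepRegimeTw` of the line's hardest stub `stub_deepRegime` (the cusp counting
law C⁺′ on the twist-aware deep regime, on the cone `X³ ≤ 8Y ≤ 8X^σ`) implies `_root_.ABC`.

Proof.  The landed arithmetic Frey–twist amplification `Summit.ABC.ABC.Theorems.FreyAmplification_proof`
(`…FreyAmplification.lean`) reduces `ABC` to the sharp count `#S ≤ C·X^{1−κ/6+ε}` of finite sets `S` of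
window data `(a, b, c, d)` (`rad(abc)d² ≤ X`, `κ log(rad·d²) ≤ 6 log(cd) ≤ σ log(rad·d²)`); we take
`κ = 4`, `σ = 12` and use the law at `σ = 13`, exponent `ε/2`.  The data with `a = b` or `(ab)² < 363c` are
`O(1)` (`card_bad_le`: `d ≤ c³`, `a, b < 726`).  The others inject by `t ↦ x(t)` (fact a0; `c = a + b`)
into the union over the `J + 1 ≪ log X` dyadic shells `(X_j, Y_j) = (min(2X, 2^{(j+1)/4}), 2^{j+1} − 1)`,
`j = ⌊log₂ M⌋ ≤ J = ⌊log₂⌊(2X)^{12}⌋⌋`, of the deep-regime sets (fact a1 and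
`twistedFreyPair_mem_deepRegimeTw`: level `M ≤ Y_j < 2M`, budget `N* ≤ 2N ≤ 2X` and
`(2N)⁴ ≤ 16(cd)⁶ ≤ M < 2^{j+1}`, thick tube from `(ab)² ≥ 363c`, `r' = 1 < Y_j^{1/6}`), each of size
`≤ 3C₀(2X)^{ε/2}(2X)^{1−4/6}` (`shell_bound`) — the dyadic bookkeeping of the landed transfer
`DeepModuli.stub_cuspTransfer` at `κ = 4` (`card_good_le`).  Support lemmas:
`…AbcOfDeepRegimeLawLemmas.lean`.
-/

noncomputable section

set_option linter.dupNamespace false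

namespace Summit.ABC.ABC.Theorems.SharpModerateLaw.CuspDispersion

open Literature.NumberTheory.DiophantineGeometry (IsABCTriple rad)

/-- **The good data inject into the shells.**  For window data `S` at `(κ, σ) = (4, 12)` with `a ≠ b` and
`(ab)² ≥ 363c`, and a family bound `#(cuspSetD ∩ DeepRegimeTw)(X₀, Y) ≤ C₀X₀^{ε/2}(X₀Y^{-1/6} + 1)` on the cone
`X₀³ ≤ 8Y ≤ 8X₀^{13}`: `#S ≤ (J + 1)·3C₀X'^{ε/2}X'^{1−4/6}`, `X' = 2X`, `J = ⌊log₂⌊X'^{12}⌋⌋` (injection by a0 into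
`⋃_{j ≤ J}` of the deep-regime sets at `(X_j, Y_j)`, membership by a1, per-shell bound `shell_bound`). -/
theorem card_good_le
    (hinj : ∀ a b d a' b' d' : ℕ, 0 < a → 0 < b → 0 < a' → 0 < b' → Nat.Coprime a b → Nat.Coprime a' b' →
      (d = 1 ∨ Nat.Prime d) → (d' = 1 ∨ Nat.Prime d') → Nat.Coprime d (a * b * (a + b)) →
      Nat.Coprime d' (a' * b' * (a' + b')) → (d : ℤ) ^ 2 * (freyPair a b).1 = (d' : ℤ) ^ 2 * (freyPair a' b').1 →
      (d : ℤ) ^ 3 * (freyPair a b).2 = (d' : ℤ) ^ 3 * (freyPair a' b').2 → a = a' ∧ b = b' ∧ d = d')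
    (hfacts : ∀ a b d : ℕ, 0 < a → 0 < b → a ≠ b → Nat.Coprime a b → (d = 1 ∨ Nat.Prime d) →
      Nat.Coprime d (a * b * (a + b)) → ∀ x : ℤ × ℤ, x = ((d : ℤ) ^ 2 * (freyPair a b).1, (d : ℤ) ^ 3 * (freyPair a b).2) →
      x.1 ≠ 0 ∧ x.2 ≠ 0 ∧ x.1 ^ 3 ≠ x.2 ^ 2 ∧ (1728 : ℤ) ∣ x.1 ^ 3 - x.2 ^ 2 ∧ TF x ∧
      Nstar x ≤ 2 * Literature.NumberTheory.DiophantineGeometry.rad a b (a + b) * d ^ 2 ∧ simpleRad x = 1 ∧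
      x.1 ^ 3 - x.2 ^ 2 = 27648 * ((a : ℤ) * b * (a + b)) ^ 2 * (d : ℤ) ^ 6 ∧ 0 < x.1 ∧
      x.1 ^ 3 = (16 * ((a : ℤ) ^ 2 + a * b + (b : ℤ) ^ 2)) ^ 3 * (d : ℤ) ^ 6 ∧
      1728 * ((a : ℤ) + b) ^ 6 ≤ (16 * ((a : ℤ) ^ 2 + a * b + (b : ℤ) ^ 2)) ^ 3 ∧
      (16 * ((a : ℤ) ^ 2 + a * b + (b : ℤ) ^ 2)) ^ 3 < 4096 * ((a : ℤ) + b) ^ 6 ∧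
      16 * ((a : ℤ) * b * (a + b)) ^ 2 ≤ (16 * ((a : ℤ) ^ 2 + a * b + (b : ℤ) ^ 2)) ^ 3 ∧
      (∀ d' : ℕ, (d' : ℤ) ^ 2 ∣ x.1 → (d' : ℤ) ^ 3 ∣ x.2 → d' ∣ 4 * d))
    {C₀ ε X : ℝ} (hC₀ : 0 ≤ C₀) (hε : 0 < ε) (hX : 1 ≤ X)
    (hC : ∀ X₀ Y : ℝ, 1 ≤ X₀ → 1 ≤ Y → X₀ ^ 3 ≤ 8 * Y → Y ≤ X₀ ^ (13 : ℝ) →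
      (Set.ncard {x : ℤ × ℤ | x ∈ cuspSetD X₀ Y ∧ DeepRegimeTw Y x} : ℝ) ≤
        C₀ * X₀ ^ (ε / 2) * (X₀ * Y ^ (-(1 / 6 : ℝ)) + 1))
    (S : Finset (ℕ × ℕ × ℕ × ℕ))
    (hS : ∀ t ∈ S, (IsABCTriple t.1 t.2.1 t.2.2.1 ∧ (t.2.2.2 = 1 ∨ Nat.Prime t.2.2.2) ∧
        Nat.Coprime t.2.2.2 (t.1 * t.2.1 * t.2.2.1) ∧
        ((rad t.1 t.2.1 t.2.2.1 : ℕ) : ℝ) * (t.2.2.2 : ℝ) ^ 2 ≤ X ∧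
        4 * Real.log (((rad t.1 t.2.1 t.2.2.1 : ℕ) : ℝ) * (t.2.2.2 : ℝ) ^ 2) ≤
          6 * Real.log ((t.2.2.1 : ℝ) * (t.2.2.2 : ℝ)) ∧
        6 * Real.log ((t.2.2.1 : ℝ) * (t.2.2.2 : ℝ)) ≤
          12 * Real.log (((rad t.1 t.2.1 t.2.2.1 : ℕ) : ℝ) * (t.2.2.2 : ℝ) ^ 2)) ∧
        (t.1 ≠ t.2.1 ∧ 363 * t.2.2.1 ≤ (t.1 * t.2.1) ^ 2)) :
    (S.card : ℝ) ≤ ((Nat.log 2 ⌊(2 * X) ^ (12 : ℝ)⌋₊ + 1 : ℕ) : ℝ) *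
      (3 * C₀ * (2 * X) ^ (ε / 2) * (2 * X) ^ (1 - 4 / 6 : ℝ)) := by
  have hX0 : 0 < X := by linarith
  set X' : ℝ := 2 * X with hX'
  have hX'2 : 2 ≤ X' := by rw [hX']; linarith
  have hX'1 : 1 ≤ X' := by linarith
  have hX'0 : 0 < X' := by linarith
  set J : ℕ := Nat.log 2 ⌊X' ^ (12 : ℝ)⌋₊ with hJ
  set Xj : ℕ → ℝ := fun j => min X' ((2 : ℝ) ^ (((j + 1 : ℕ) : ℝ) / 4)) with hXj
  set Yj : ℕ → ℝ := fun j => 2 * (2 : ℝ) ^ j - 1 with hYj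
  set D : ℕ → Set (ℤ × ℤ) := fun j => {x : ℤ × ℤ | x ∈ cuspSetD (Xj j) (Yj j) ∧ DeepRegimeTw (Yj j) x} with hD
  have h2j1 : ∀ j : ℕ, (1 : ℝ) ≤ (2 : ℝ) ^ j := fun j => one_le_pow₀ (by norm_num)
  have hYj1 : ∀ j : ℕ, 1 ≤ Yj j := fun j => by simp only [hYj]; linarith [h2j1 j]
  set U : Set (ℤ × ℤ) := ⋃ j ∈ Finset.range (J + 1), D j with hU
  have hfin : U.Finite :=
    Set.Finite.biUnion (Finset.range (J + 1)).finite_toSet fun j _ => sepSet_finite DeepRegimeTw (Xj j) (Yj j) (hYj1 j)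
  set f : ℕ × ℕ × ℕ × ℕ → ℤ × ℤ :=
    fun t => ((t.2.2.2 : ℤ) ^ 2 * (freyPair t.1 t.2.1).1, (t.2.2.2 : ℤ) ^ 3 * (freyPair t.1 t.2.1).2) with hf
  -- Step 1: `t ↦ x(t)` maps `S` into `U`
  have hmaps : ∀ t ∈ (S : Set (ℕ × ℕ × ℕ × ℕ)), f t ∈ U := by
    rintro ⟨a, b, c, d⟩ ht
    obtain ⟨⟨⟨ha, hb, hsum, hcop⟩, hd, hdcop, hNX, hw1, hw2⟩, hne, hthick⟩ := hS _ (Finset.mem_coe.mp ht)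
    dsimp only at ha hb hsum hcop hd hdcop hNX hw1 hw2 hne hthick
    subst hsum
    obtain ⟨hx1, hx2, hx3, h1728, hTF, hN, hsr, hDval, hpos, hM, hlo, hhi, hsyz, htw⟩ :=
      hfacts a b d ha hb hne hcop hd hdcop _ rfl
    have hr : 0 < rad a b (a + b) := by
      rw [Literature.NumberTheory.DiophantineGeometry.rad_def]; exact Nat.radical_pos _
    have hd0 : 0 < d := hd.elim (fun h => h ▸ one_pos) (fun h => h.pos)
    obtain ⟨hN4, hN12, -⟩ := window_pow hr (by omega) hd0 hw1 hw2
    have ha1 : (1 : ℝ) ≤ a := by exact_mod_cast ha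
    have hb1 : (1 : ℝ) ≤ b := by exact_mod_cast hb
    have hd1 : (1 : ℝ) ≤ d := by exact_mod_cast hd0
    have hr1 : (1 : ℝ) ≤ (rad a b (a + b) : ℝ) := by exact_mod_cast hr
    -- the level `M = (16A)³d⁶` and its shell index `j`
    set Mn : ℕ := (16 * (a ^ 2 + a * b + b ^ 2)) ^ 3 * d ^ 6 with hMn
    have hMn0 : Mn ≠ 0 := by positivity
    set A : ℝ := (a : ℝ) ^ 2 + a * b + (b : ℝ) ^ 2 with hA
    set M : ℝ := (16 * A) ^ 3 * (d : ℝ) ^ 6 with hMdef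
    have hMcast : (Mn : ℝ) = M := by rw [hMn, hMdef, hA]; push_cast; ring
    set j : ℕ := Nat.log 2 Mn with hj
    obtain ⟨hMY, hYM⟩ := level_window hMn0
    rw [hMcast] at hMY hYM
    -- the window in multiplicative form: `N = rad·d² ≤ X`, `N⁴ ≤ (cd)⁶ ≤ N¹²`
    set N : ℝ := (rad a b (a + b) : ℝ) * (d : ℝ) ^ 2 with hNdef
    set cR : ℝ := ((a + b : ℕ) : ℝ) with hcR
    have hcR' : cR = (a : ℝ) + b := by rw [hcR]; push_cast; ring
    have hN1 : 1 ≤ N := by rw [hNdef]; nlinarith [one_le_pow₀ (n := 2) hd1]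
    have hloR : 1728 * ((a : ℝ) + b) ^ 6 ≤ (16 * A) ^ 3 := by rw [hA]; exact_mod_cast hlo
    have hhiR : (16 * A) ^ 3 < 4096 * ((a : ℝ) + b) ^ 6 := by rw [hA]; exact_mod_cast hhi
    have hd6 : (0 : ℝ) < (d : ℝ) ^ 6 := by positivity
    have hcdM : 1728 * (cR * d) ^ 6 ≤ M := by
      rw [hMdef, hcR']
      calc 1728 * (((a : ℝ) + b) * d) ^ 6 = 1728 * ((a : ℝ) + b) ^ 6 * (d : ℝ) ^ 6 := by ring
        _ ≤ (16 * A) ^ 3 * (d : ℝ) ^ 6 := mul_le_mul_of_nonneg_right hloR hd6.le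
    have hMcd : M < 4096 * (cR * d) ^ 6 := by
      rw [hMdef, hcR']
      calc (16 * A) ^ 3 * (d : ℝ) ^ 6 < 4096 * ((a : ℝ) + b) ^ 6 * (d : ℝ) ^ 6 :=
            mul_lt_mul_of_pos_right hhiR hd6
        _ = 4096 * (((a : ℝ) + b) * d) ^ 6 := by ring
    -- the budget: `N* ≤ 2N ≤ X'` and `(2N)⁴ ≤ 16(cd)⁶ ≤ M < 2·2^j`
    have hNstar : (Nstar ((d : ℤ) ^ 2 * (freyPair a b).1, (d : ℤ) ^ 3 * (freyPair a b).2) : ℝ) ≤ 2 * N := by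
      have h' : ((Nstar ((d : ℤ) ^ 2 * (freyPair a b).1, (d : ℤ) ^ 3 * (freyPair a b).2) : ℕ) : ℝ) ≤
          ((2 * rad a b (a + b) * d ^ 2 : ℕ) : ℝ) := by exact_mod_cast hN
      rw [hNdef]
      push_cast at h'
      linarith
    have hNX' : 2 * N ≤ X' := by rw [hX']; linarith
    have hN4' : (2 * N) ^ 4 < 2 * (2 : ℝ) ^ j := by
      calc (2 * N) ^ 4 = 16 * N ^ 4 := by ring
        _ ≤ 16 * (cR * d) ^ 6 := by linarith
        _ ≤ 1728 * (cR * d) ^ 6 := by nlinarith [pow_nonneg (by positivity : (0 : ℝ) ≤ cR * d) 6]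
        _ ≤ M := hcdM
        _ < 2 * (2 : ℝ) ^ j := by linarith
    have hbudget : (Nstar ((d : ℤ) ^ 2 * (freyPair a b).1, (d : ℤ) ^ 3 * (freyPair a b).2) : ℝ) ≤ Xj j :=
      le_min (hNstar.trans hNX') (le_budget_of_pow_four_lt (lt_of_le_of_lt
        (pow_le_pow_left₀ (by positivity) hNstar 4) hN4'))
    -- membership in the deep-regime set of shell `j`
    have hmem := mem_deep_of_facts ha hb hd0 hx1 hx2 hx3 h1728 hTF hsr hDval hpos hM hhi hsyz htw hthick
      hbudget hMY hYM
    -- the shell index is in range: `M < 4096(cd)⁶ ≤ 4096N¹² ≤ (2X)¹²`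
    have hjJ : j ≤ J := by
      apply log_le_of_lt_rpow
      rw [hMcast, show (12 : ℝ) = ((12 : ℕ) : ℝ) by norm_num, Real.rpow_natCast]
      have hN0 : 0 ≤ N := by linarith
      have hNX12 : N ^ 12 ≤ X ^ 12 := pow_le_pow_left₀ hN0 (by rw [hNdef]; exact hNX) 12
      calc M ≤ 4096 * (cR * d) ^ 6 := hMcd.le
        _ ≤ 4096 * N ^ 12 := by linarith
        _ ≤ 4096 * X ^ 12 := by linarith
        _ = X' ^ 12 := by rw [hX']; ring
    rw [hU]
    simp only [Set.mem_iUnion, Finset.mem_range]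
    exact ⟨j, Nat.lt_succ_of_le hjJ, hmem⟩
  -- Step 2: injectivity (fact a0; `c = a + b` is determined)
  have hinjOn : Set.InjOn f (S : Set (ℕ × ℕ × ℕ × ℕ)) := by
    rintro ⟨a, b, c, d⟩ ht ⟨a', b', c', d'⟩ ht' heq
    obtain ⟨⟨⟨ha, hb, hsum, hcop⟩, hd, hdcop, -, -, -⟩, -, -⟩ := hS _ (Finset.mem_coe.mp ht)
    obtain ⟨⟨⟨ha', hb', hsum', hcop'⟩, hd', hdcop', -, -, -⟩, -, -⟩ := hS _ (Finset.mem_coe.mp ht')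
    dsimp only at ha hb hsum hcop hd hdcop ha' hb' hsum' hcop' hd' hdcop' heq
    subst hsum hsum'
    simp only [hf, Prod.mk.injEq] at heq
    obtain ⟨h1, h2, h3⟩ := hinj a b d a' b' d' ha hb ha' hb' hcop hcop' hd hd' hdcop hdcop' heq.1 heq.2
    subst h1 h2 h3
    rfl
  have h1 : S.card ≤ U.ncard := by
    have h := Set.ncard_le_ncard_of_injOn f hmaps hinjOn hfin
    rwa [Set.ncard_coe_finset] at h
  have h3 : U.ncard ≤ ∑ j ∈ Finset.range (J + 1), (D j).ncard := Finset.set_ncard_biUnion_le _ _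
  -- Step 3: the per-shell bound and the sum over shells
  have hshell : ∀ j ∈ Finset.range (J + 1), ((D j).ncard : ℝ) ≤ 3 * C₀ * X' ^ (ε / 2) * X' ^ (1 - 4 / 6 : ℝ) := by
    intro j hj
    have hjJ : j ≤ J := Nat.lt_succ_iff.mp (Finset.mem_range.mp hj)
    exact shell_bound (D := fun X₀ Y => {x : ℤ × ℤ | x ∈ cuspSetD X₀ Y ∧ DeepRegimeTw Y x}) hC₀ hε hX'2 hC
      (two_pow_le_of_le_log hX'1 hjJ)
  calc (S.card : ℝ) ≤ (U.ncard : ℝ) := by exact_mod_cast h1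
    _ ≤ ((∑ j ∈ Finset.range (J + 1), (D j).ncard : ℕ) : ℝ) := by exact_mod_cast h3
    _ = ∑ j ∈ Finset.range (J + 1), ((D j).ncard : ℝ) := by push_cast; rfl
    _ ≤ ∑ _j ∈ Finset.range (J + 1), 3 * C₀ * X' ^ (ε / 2) * X' ^ (1 - 4 / 6 : ℝ) := Finset.sum_le_sum hshell
    _ = ((J + 1 : ℕ) : ℝ) * (3 * C₀ * X' ^ (ε / 2) * X' ^ (1 - 4 / 6 : ℝ)) := by
        rw [Finset.sum_const, Finset.card_range, nsmul_eq_mul]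

/-- Registered calibration sub-goal a2 `abc_of_lawOn_deepRegimeTw_of_facts` of stmt-ABC-1975 (line
`deep-moduli-cusp-dispersion`): given the twisted-Frey-pair facts a0 (injectivity) and a1 (invariants), the
deep-regime law `LawOn DeepRegimeTw` alone implies the summit `_root_.ABC` (via `FreyAmplification_proof` at
`κ = 4`, `σ = 12`; law used at `σ = 13`, exponent `ε/2`). -/
theorem abc_of_lawOn_deepRegimeTw_of_facts : (∀ a b d a' b' d' : ℕ, 0 < a → 0 < b → 0 < a' → 0 < b' → Nat.Coprime a b → Nat.Coprime a' b' → (d = 1 ∨ Nat.Prime d) → (d' = 1 ∨ Nat.Prime d') → Nat.Coprime d (a * b * (a + b)) → Nat.Coprime d' (a' * b' * (a' + b')) → (d : ℤ) ^ 2 * (freyPair a b).1 = (d' : ℤ) ^ 2 * (freyPair a' b').1 → (d : ℤ) ^ 3 * (freyPair a b).2 = (d' : ℤ) ^ 3 * (freyPair a' b').2 → a = a' ∧ b = b' ∧ d = d') → (∀ a b d : ℕ, 0 < a → 0 < b → a ≠ b → Nat.Coprime a b → (d = 1 ∨ Nat.Prime d) → Nat.Coprime d (a * b * (a + b)) → ∀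 x : ℤ × ℤ, x = ((d : ℤ) ^ 2 * (freyPair a b).1, (d : ℤ) ^ 3 * (freyPair a b).2) → x.1 ≠ 0 ∧ x.2 ≠ 0 ∧ x.1 ^ 3 ≠ x.2 ^ 2 ∧ (1728 : ℤ) ∣ x.1 ^ 3 - x.2 ^ 2 ∧ TF x ∧ Nstar x ≤ 2 * Literature.NumberTheory.DiophantineGeometry.rad a b (a + b) * d ^ 2 ∧ simpleRad x = 1 ∧ x.1 ^ 3 - x.2 ^ 2 = 27648 * ((a : ℤ) * b * (a + b)) ^ 2 * (d : ℤ) ^ 6 ∧ 0 < x.1 ∧ x.1 ^ 3 = (16 * ((a : ℤ) ^ 2 + a * b + (b : ℤ) ^ 2)) ^ 3 * (d : ℤ) ^ 6 ∧ 1728 * ((a : ℤ) + b) ^ 6 ≤ (16 * ((a : ℤ) ^ 2 + a * b + (b : ℤ) ^ 2)) ^ 3 ∧ (16 * ((a : ℤ) ^ 2 + a * b + (b : ℤ) ^ 2)) ^ 3 < 4096 * ((a : ℤ) + b) ^ 6 ∧ 16 * ((a : ℤ) * b * (a + b)) ^ 2 ≤ (16 * ((a : ℤ) ^ 2 + a *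 b + (b : ℤ) ^ 2)) ^ 3 ∧ (∀ d' : ℕ, (d' : ℤ) ^ 2 ∣ x.1 → (d' : ℤ) ^ 3 ∣ x.2 → d' ∣ 4 * d)) → LawOn DeepRegimeTw → _root_.ABC := by
  intro hinj hfacts hlaw
  refine Summit.ABC.ABC.Theorems.FreyAmplification_proof ⟨4, 12, by norm_num, by norm_num, by norm_num, fun ε hε => ?_⟩
  have hε2 : 0 < ε / 2 := by positivity
  obtain ⟨C, hC⟩ := hlaw 13 (by norm_num) (ε / 2) hε2
  set C₀ : ℝ := max C 0 with hC₀
  have hC₀0 : 0 ≤ C₀ := le_max_right _ _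
  have hC' : ∀ X₀ Y : ℝ, 1 ≤ X₀ → 1 ≤ Y → X₀ ^ 3 ≤ 8 * Y → Y ≤ X₀ ^ (13 : ℝ) →
      (Set.ncard {x : ℤ × ℤ | x ∈ cuspSetD X₀ Y ∧ DeepRegimeTw Y x} : ℝ) ≤
        C₀ * X₀ ^ (ε / 2) * (X₀ * Y ^ (-(1 / 6 : ℝ)) + 1) := by
    intro X₀ Y h1 h2 h3 h4
    refine (hC X₀ Y h1 h2 h3 h4).trans ?_
    rw [mul_assoc, mul_assoc]
    exact mul_le_mul_of_nonneg_right (le_max_left _ _) (bound_nonneg h1 h2)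
  set K₁ : ℝ := ((726 * (726 * (1451 * (1450 ^ 3 + 1))) : ℕ) : ℝ) with hK₁
  set K₂ : ℝ := 3 * C₀ * (2 * 12 / (ε * Real.log 2) + 1) with hK₂
  have hlog2 : 0 < Real.log 2 := Real.log_pos (by norm_num)
  have hK₂0 : 0 ≤ K₂ := by rw [hK₂]; positivity
  have hexp0 : 0 ≤ 1 - 4 / 6 + ε := by linarith
  refine ⟨K₁ + (2 : ℝ) ^ (1 - 4 / 6 + ε) * K₂, fun X hX S hS => ?_⟩
  have hX0 : 0 < X := by linarith
  classical
  -- split the data into good (`a ≠ b`, `(ab)² ≥ 363c`) and exceptional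
  set p : ℕ × ℕ × ℕ × ℕ → Prop := fun t => t.1 ≠ t.2.1 ∧ 363 * t.2.2.1 ≤ (t.1 * t.2.1) ^ 2 with hp
  have hsplit : (S.filter p).card + (S.filter (fun t => ¬ p t)).card = S.card :=
    Finset.card_filter_add_card_filter_not p
  have hgood := card_good_le hinj hfacts hC₀0 hε hX hC' (S.filter p)
    (fun t ht => ⟨hS t (Finset.mem_filter.mp ht).1, (Finset.mem_filter.mp ht).2⟩)
  have hbad : ((S.filter (fun t => ¬ p t)).card : ℝ) ≤ K₁ := by
    rw [hK₁]
    exact_mod_cast card_bad_le (X := X) (S.filter (fun t => ¬ p t))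
      (fun t ht => ⟨hS t (Finset.mem_filter.mp ht).1, (Finset.mem_filter.mp ht).2⟩)
  -- the number of shells and the powers of `X' = 2X`
  have hX'1 : (1 : ℝ) ≤ 2 * X := by linarith
  have hX'0 : (0 : ℝ) < 2 * X := by linarith
  have hcount := card_shells_le (σ := 12) (ε := ε) (by norm_num) hε hX'1
  have hpow1 : 1 ≤ X ^ (1 - 4 / 6 + ε) := Real.one_le_rpow hX hexp0
  have hX'pow : (2 * X) ^ (1 - 4 / 6 + ε) = (2 : ℝ) ^ (1 - 4 / 6 + ε) * X ^ (1 - 4 / 6 + ε) :=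
    Real.mul_rpow (by norm_num) hX0.le
  have hmerge : (2 * X) ^ (ε / 2) * ((2 * X) ^ (ε / 2) * (2 * X) ^ (1 - 4 / 6 : ℝ)) = (2 * X) ^ (1 - 4 / 6 + ε) := by
    rw [← Real.rpow_add hX'0, ← Real.rpow_add hX'0]
    congr 1
    ring
  have hmain_nonneg : 0 ≤ 3 * C₀ * (2 * X) ^ (ε / 2) * (2 * X) ^ (1 - 4 / 6 : ℝ) := by positivity
  calc (S.card : ℝ) = ((S.filter p).card : ℝ) + ((S.filter (fun t => ¬ p t)).card : ℝ) := by
        rw [← hsplit]; push_cast; ring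
    _ ≤ ((Nat.log 2 ⌊(2 * X) ^ (12 : ℝ)⌋₊ + 1 : ℕ) : ℝ) *
          (3 * C₀ * (2 * X) ^ (ε / 2) * (2 * X) ^ (1 - 4 / 6 : ℝ)) + K₁ := add_le_add hgood hbad
    _ ≤ ((2 * 12 / (ε * Real.log 2) + 1) * (2 * X) ^ (ε / 2)) *
          (3 * C₀ * (2 * X) ^ (ε / 2) * (2 * X) ^ (1 - 4 / 6 : ℝ)) + K₁ := by
        gcongr
    _ = K₂ * ((2 * X) ^ (ε / 2) * ((2 * X) ^ (ε / 2) * (2 * X) ^ (1 - 4 / 6 : ℝ))) + K₁ := by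
        rw [hK₂]; ring
    _ = K₂ * ((2 : ℝ) ^ (1 - 4 / 6 + ε) * X ^ (1 - 4 / 6 + ε)) + K₁ := by rw [hmerge, hX'pow]
    _ ≤ K₂ * ((2 : ℝ) ^ (1 - 4 / 6 + ε) * X ^ (1 - 4 / 6 + ε)) + K₁ * X ^ (1 - 4 / 6 + ε) := by
        have hK₁0 : 0 ≤ K₁ := by rw [hK₁]; positivity
        nlinarith
    _ = (K₁ + (2 : ℝ) ^ (1 - 4 / 6 + ε) * K₂) * X ^ (1 - 4 / 6 + ε) := by ring

end Summit.ABC.ABC.Theorems.SharpModerateLaw.CuspDispersion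

end
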